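import Summits.NavierStokesRegularity.NavierStokesRegularity.Theses.AxisymmetricExtremality
import Summits.NavierStokesRegularity.NavierStokesRegularity.Theorems.AxisymmetricExtremalityAxisymmetricKatoGlobalStubSeregin2020TypeIINoSwirlCoreVelocityBound
import Literature.Analysis.FluidPDE.NSVorticityOfSmoothRepresentative
import HarnessLib

/-!
# Seregin 2020, proof of Thm 2.1, the no-swirl endgame core: the velocity is bounded by its curl
# and its local `L¹` norm — scaled and localised form

Helper toward the stub `stub_seregin2020TypeII` of the crux `AxisymmetricKatoGlobal` (= the named
fact `Literature.Analysis.FluidPDE.Seregin2020_axisymmetricSingularPoint_typeII`, G. Seregin,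
Anal. Math. Phys. 10 (2020) Paper 46 = arXiv:2006.04140, Thm 2.1), last paragraph of the
printed proof (arXiv p. 8): bounded vorticity plus the energy class give a bounded velocity near
the clean first singular point. The sibling `exists_const_norm_le_of_curl_le_unit` is the unit
scale statement for a GLOBALLY `C²` field; the smooth representative of the blow-up limit is
`C^∞` only on a ball, at an arbitrary (small) scale. This file provides the form that is used:

* `fderiv_comp_const_add_smul`, `curl_comp_const_add_smul_eq`,
  `divergence_comp_const_add_smul` — the derivative, curl and divergence of the rescaled field
  `z ↦ v(x + s z)` (no differentiability hypotheses: both sides are junk together);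
* `exists_const_norm_le_of_curl_le_local` — there is an absolute `C` with
  `‖v(x)‖ ≤ 2Λs + C s⁻³ ∫_{B̄(x, 2s)} ‖v‖` for every `s > 0` and every field `v` which is `C²`,
  divergence free and has `‖curl v‖ ≤ Λ` at the points of `B(x, 3s)` (globalise `v` near
  `B̄(x, 5s/2)` by a cut-off, rescale to the unit picture, change variables in the integral).

## References

* G. Seregin, Anal. Math. Phys. 10 (2020), Paper 46 = arXiv:2006.04140, proof of Thm. 2.1, last
  paragraph (arXiv p. 8). [Seregin2020]
* J. Serrin, Arch. Rational Mech. Anal. 9 (1962) 187–195 (interior estimate of the velocity by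
  the vorticity). [Serrin1962]
-/

-- the problem directory repeats the summit name (D-0017); core's `dupNamespace` linter fires
set_option linter.dupNamespace false

noncomputable section

open MeasureTheory Set Function Filter Topology TopologicalSpace Metric
open scoped NNReal ENNReal ContDiff

namespace Summit.NavierStokesRegularity.NavierStokesRegularity.Theorems.AxisymmetricKatoGlobal.EulerScaling

open Literature.Analysis.FluidPDE

/-! ### Rescaling `z ↦ v(x + s z)` -/

section Rescale

variable (g : EuclideanSpace ℝ (Fin 3) → EuclideanSpace ℝ (Fin 3)) (x : EuclideanSpace ℝ (Fin 3))
  (s : ℝ)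

/-- `D(g(x + s ·))(z) = s · Dg(x + s z)` (junk values included). [folklore] -/
theorem fderiv_comp_const_add_smul (z : EuclideanSpace ℝ (Fin 3)) :
    fderiv ℝ (fun z => g (x + s • z)) z = s • fderiv ℝ g (x + s • z) := by
  have h2 := fderiv_comp_smul (𝕜 := ℝ) (f := fun w => g (x + w)) (x := z) s
  simp only [fderiv_comp_add_left] at h2
  exact h2

/-- `curl (g(x + s ·))(z) = s · (curl g)(x + s z)`. [folklore] -/
theorem curl_comp_const_add_smul_eq (z : EuclideanSpace ℝ (Fin 3)) :
    curl (fun z => g (x + s • z)) z = s • curl g (x + s • z) := by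
  rw [curl_eq_curlCLM, curl_eq_curlCLM, fderiv_comp_const_add_smul, map_smul]

/-- `div (g(x + s ·))(z) = s · (div g)(x + s z)`. [folklore] -/
theorem divergence_comp_const_add_smul (z : EuclideanSpace ℝ (Fin 3)) :
    VectorCalculus.divergence (fun z => g (x + s • z)) z =
      s * VectorCalculus.divergence g (x + s • z) := by
  unfold VectorCalculus.divergence
  rw [fderiv_comp_const_add_smul, ContinuousLinearMap.toLinearMap_smul, map_smul, smul_eq_mul]

/-- The rescaling maps `B̄(0, 2)` into `B̄(x, 2s)` for `s > 0`. [folklore] -/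
theorem const_add_smul_mem_closedBall {s : ℝ} (hs : 0 < s) {z : EuclideanSpace ℝ (Fin 3)}
    (hz : z ∈ closedBall (0 : EuclideanSpace ℝ (Fin 3)) 2) : x + s • z ∈ closedBall x (2 * s) := by
  rw [mem_closedBall, dist_eq_norm, add_sub_cancel_left, norm_smul, Real.norm_of_nonneg hs.le]
  rw [mem_closedBall, dist_zero_right] at hz
  nlinarith

end Rescale

/-! ### The localised, scaled sup bound -/

/-- **Sup bound for a locally smooth field by its curl and its local `L¹` norm, at scale `s`.**
There is an absolute constant `C ≥ 0` such that for every `s > 0`, every centre `x` and every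
field `v` which, at the points of `B(x, 3s)`, is `C²`, divergence free and has `‖curl v‖ ≤ Λ`:
`‖v(x)‖ ≤ 2Λs + C s⁻³ ∫_{B̄(x, 2s)} ‖v‖`. Proof: `v` agrees near `B̄(x, 5s/2)` with a global `C²`
field `g` (`ContDiffOn.exists_contDiff_eqOn_nhds_of_isCompact`); the unit statement
`exists_const_norm_le_of_curl_le_unit` for `u = g(x + s ·)` at `0` (`curl u = s (curl g) ∘ …`,
`div u = s (div g) ∘ …`), and the change of variables `∫_{B̄(0,2)} ‖u‖ = s⁻³ ∫_{B̄(x,2s)} ‖v‖`.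
[cite: Serrin1962, §1 (interior estimate of the velocity by the vorticity)] -/
theorem exists_const_norm_le_of_curl_le_local :
    ∃ C : ℝ, 0 ≤ C ∧ ∀ (v : EuclideanSpace ℝ (Fin 3) → EuclideanSpace ℝ (Fin 3))
      (x : EuclideanSpace ℝ (Fin 3)) (s Λ : ℝ), 0 < s →
      (∀ y ∈ ball x (3 * s), ContDiffAt ℝ 2 v y) →
      (∀ y ∈ ball x (3 * s), VectorCalculus.divergence v y = 0) →
      (∀ y ∈ ball x (3 * s), ‖curl v y‖ ≤ Λ) →
      ‖v x‖ ≤ 2 * Λ * s + C * (s ^ 3)⁻¹ * ∫ y in closedBall x (2 * s), ‖v y‖ := by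
  obtain ⟨C, hC0, hC⟩ := exists_const_norm_le_of_curl_le_unit
  refine ⟨C, hC0, fun v x s Λ hs hv hdiv hcurl => ?_⟩
  -- ## globalise `v` near `B̄(x, 5s/2)`
  have hvOn : ContDiffOn ℝ 2 v (ball x (3 * s)) := fun y hy => (hv y hy).contDiffWithinAt
  obtain ⟨g, hg, N, hNo, hKN, hNU, hgv⟩ := hvOn.exists_contDiff_eqOn_nhds_of_isCompact isOpen_ball
    (isCompact_closedBall x (5 / 2 * s)) (closedBall_subset_ball (by linarith))
  have hfd : ∀ y ∈ N, fderiv ℝ g y = fderiv ℝ v y := fun y hy =>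
    (hgv.eventuallyEq_of_mem (hNo.mem_nhds hy)).fderiv_eq
  have h2N : closedBall x (2 * s) ⊆ N := (closedBall_subset_closedBall (by linarith)).trans hKN
  have h2U : closedBall x (2 * s) ⊆ ball x (3 * s) := closedBall_subset_ball (by linarith)
  -- ## the rescaled field
  set u : EuclideanSpace ℝ (Fin 3) → EuclideanSpace ℝ (Fin 3) := fun z => g (x + s • z) with hu
  have hu2 : ContDiff ℝ 2 u := hg.comp (contDiff_const.add (contDiff_id.const_smul s))
  have hdivu : ∀ z ∈ closedBall (0 : EuclideanSpace ℝ (Fin 3)) 2,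
      VectorCalculus.divergence u z = 0 := by
    intro z hz
    have hy := const_add_smul_mem_closedBall x hs hz
    rw [hu, divergence_comp_const_add_smul]
    have e : VectorCalculus.divergence g (x + s • z) = VectorCalculus.divergence v (x + s • z) := by
      unfold VectorCalculus.divergence
      rw [hfd _ (h2N hy)]
    rw [e, hdiv _ (h2U hy), mul_zero]
  have hcurlu : ∀ z ∈ closedBall (0 : EuclideanSpace ℝ (Fin 3)) 2, ‖curl u z‖ ≤ s * Λ := by
    intro z hz
    have hy := const_add_smul_mem_closedBall x hs hz
    rw [hu, curl_comp_const_add_smul_eq, norm_smul, Real.norm_of_nonneg hs.le, curl_eq_curlCLM,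
      hfd _ (h2N hy), ← curl_eq_curlCLM]
    exact mul_le_mul_of_nonneg_left (hcurl _ (h2U hy)) hs.le
  have key := hC u 0 (s * Λ) hu2 hdivu hcurlu
  -- ## `u 0 = v x`
  have hu0 : u 0 = v x := by
    simp only [hu, smul_zero, add_zero]
    exact hgv (hKN (mem_closedBall_self (by positivity)))
  -- ## the change of variables in the integral
  have hint : ∫ z in closedBall (0 : EuclideanSpace ℝ (Fin 3)) 2, ‖u z‖ =
      (s ^ 3)⁻¹ * ∫ y in closedBall x (2 * s), ‖v y‖ := by
    have h1 := Measure.setIntegral_comp_smul_of_pos volume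
      (fun y : EuclideanSpace ℝ (Fin 3) => ‖g (x + y)‖) (closedBall (0 : EuclideanSpace ℝ (Fin 3)) 2) hs
    rw [finrank_euclideanSpace_fin, smul_eq_mul, _root_.smul_closedBall s _ zero_le_two, smul_zero,
      Real.norm_of_nonneg hs.le, mul_comm s 2] at h1
    have h2 : ∫ z in closedBall (0 : EuclideanSpace ℝ (Fin 3)) 2, ‖u z‖ =
        ∫ z in closedBall (0 : EuclideanSpace ℝ (Fin 3)) 2, ‖g (x + s • z)‖ := rfl
    rw [h2, h1]
    congr 1
    -- translate and replace `g` by `v`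
    have h3 := (measurePreserving_add_left volume x).setIntegral_preimage_emb
      (measurableEmbedding_addLeft x) (fun y => ‖g y‖) (closedBall x (2 * s))
    have hpre : (fun y : EuclideanSpace ℝ (Fin 3) => x + y) ⁻¹' closedBall x (2 * s) =
        closedBall 0 (2 * s) := by
      ext y
      simp only [mem_preimage, mem_closedBall, dist_eq_norm, add_sub_cancel_left, sub_zero]
    rw [hpre] at h3
    rw [h3]
    exact setIntegral_congr_fun measurableSet_closedBall fun y hy => by rw [hgv (h2N hy)]
  rw [hu0, hint] at key
  have e : 2 * (s * Λ) + C * ((s ^ 3)⁻¹ * ∫ y in closedBall x (2 * s), ‖v y‖) =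
      2 * Λ * s + C * (s ^ 3)⁻¹ * ∫ y in closedBall x (2 * s), ‖v y‖ := by ring
  linarith

end Summit.NavierStokesRegularity.NavierStokesRegularity.Theorems.AxisymmetricKatoGlobal.EulerScaling

end
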